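import Literature.AnabelianGeometry.SemiGraphs.PSCThreeChainShape
import Literature.AnabelianGeometry.SemiGraphs.PSCSeparatingCoveringsCrossVertex
import HarnessLib

/-!
# [CombGC] Prop. 1.2, proof p. 9: VERTICIAL separating coverings at the THREE-COMPONENT CHAIN (row F-2829, verticial conjunct)

Mochizuki, *A combinatorial version of the Grothendieck conjecture*, Tohoku Math. J. **59** (2007)
[CombGC], PROOF of Proposition 1.2, p. 9: "if `v₁ ≠ v₂` …, then there exists a finite étale … covering
`G' → G` whose restriction to the anabelioid `G_{v₂}` is trivial …, but whose restriction to `G_{v₁}` is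
nontrivial" [cite: MochizukiCombGC2007, Prop 1.2 proof p.9].  Typed LEVEL-WISE by abc-iut-w4-d081 as
`PSCDatum.VerticialSeparatingCoverings` (row P12-L01-V), the verticial conjunct of FACT rows F-2829
`SeparatingCoverings` / F-2830 `SeparatingCoveringsHolds Ω` (universal closures refuted; instance forms at
genuine carriers are the content: one-vertex data (vacuous), abc-iut-f-166's two-component affine data).

PROOF-ONLY file (abc-iut-f-164 gen 4): the instance at the THREE-COMPONENT CHAIN data of gen 3
(`PSCThreeChainShape.lean`: `C₀ ∪_{ν_A} C_mid ∪_{ν_B} C₁`, TWO nodes, THREE vertices, any genera;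
`ι : Γ_{g,r} → Π` a profinite pro-`Σ` completion).  Gen 3's ONE free basis `B` of `Γ_{g,r}`
(`exists_chainBases`) carries all three vertex groups as sub-basis closures (`closure_chain{First,Mid,Last}_eq`,
index sets `S₀`, `S_mid`, `S₁`), so abc-iut-f-166's engine `verticialSeparatingCoverings_of_freeFactors'`
applies with the SAME basis at every vertex: same-vertex pairs by the fibred twist, cross-vertex pairs by the
projection killing `B(S_{v₂})`, which fixes the basis member `c_{s₂+1} ∈ Π_{v₀}` / `c_{s₁+1} ∈ Π_{v_mid}` /
`c_1 ∈ Π_{v₁}` of the alive vertex (slots outside the other two index sets).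

* `verticialSeparatingCoverings_of_threeChain` — `G.VerticialSeparatingCoverings` (`V' := V`) at every
  three-component chain datum.

A shape instance is consistency evidence for the typed schema, not the printed statement for all pointed
stable curves (cell FOUNDATIONS rows 13–14).  0 definitions; nothing here takes a side on [IUTchIII] Cor. 3.12.
-/

noncomputable section

namespace Literature.AnabelianGeometry.SemiGraphs

namespace PSCDatum

open scoped Pointwise
open Literature.GroupTheory.CombinatorialGroupTheory
open Literature.GroupTheory.CombinatorialGroupTheory.PuncturedSurfaceGroup (a b c cuspInertia
  exists_chainBases closure_chainFirst_eq closure_chainLast_eq closure_chainMid_eq)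
open SemiGraphOfAnabelioids (IsProSigmaCompletion)

variable {P : Type} [Group P] [TopologicalSpace P] [IsTopologicalGroup P]
variable [CompactSpace P] [T2Space P] [TotallyDisconnectedSpace P] {Sigma : Set ℕ} {g r : ℕ}

/-- **Row P12-L01-V (`VerticialSeparatingCoverings`, verticial conjunct of F-2829) at the genuine
THREE-COMPONENT CHAIN data** (two nodes, three vertices, any genera; `2 ≤ s₁`, `s₁ + 2 ≤ s₂`, `s₂ + 2 ≤ r`):
for every open normal `V` and any two DISTINCT level-`V` vertices there is an open `U ≤ V` (`V' := V`),
normal in `V`, trivial over the second and nontrivial over the first.  ONE free basis for all three vertices;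
cross-vertex witnesses `c_{s₂+1}`, `c_{s₁+1}`, `c_1`. [cite: MochizukiCombGC2007, Prop 1.2 proof p.9] -/
theorem verticialSeparatingCoverings_of_threeChain (hne : Sigma.Nonempty)
    (hprime : ∀ p ∈ Sigma, p.Prime) (ι : PuncturedSurfaceGroup g r →* P)
    (hι : IsProSigmaCompletion Sigma ι) (G : PSCDatum P) {g₀ g₁ s₁ s₂ : ℕ} (hg : g₀ ≤ g₁) (hs₁ : 2 ≤ s₁)
    (hs₁₂ : s₁ + 2 ≤ s₂) (hs₂ : s₂ + 2 ≤ r) (e : G.graph.C ≃ Fin r)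
    (hC : ∀ c', G.cuspGp c' = ((cuspInertia (g := g) (e c')).map ι).topologicalClosure)
    (v₀ vm v₁ : G.graph.V) (hV : ∀ w, w = v₀ ∨ w = vm ∨ w = v₁) (εA η : PuncturedSurfaceGroup g r)
    (hεA : εA = ((List.finRange r).map fun j : Fin r =>
          if s₂ ≤ (j : ℕ) then PuncturedSurfaceGroup.c (g := g) j else 1).prod *
        ((List.finRange g).map fun i : Fin g => if (i : ℕ) < g₀ then
          PuncturedSurfaceGroup.a (r := r) i * PuncturedSurfaceGroup.b i *
            (PuncturedSurfaceGroup.a i)⁻¹ * (PuncturedSurfaceGroup.b i)⁻¹ else 1).prod)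
    (hη : η = ((List.finRange r).map fun j : Fin r =>
          if s₁ ≤ (j : ℕ) then PuncturedSurfaceGroup.c (g := g) j else 1).prod *
        ((List.finRange g).map fun i : Fin g => if (i : ℕ) < g₁ then
          PuncturedSurfaceGroup.a (r := r) i * PuncturedSurfaceGroup.b i *
            (PuncturedSurfaceGroup.a i)⁻¹ * (PuncturedSurfaceGroup.b i)⁻¹ else 1).prod)
    (hV₀ : G.vertGp v₀ = ((Subgroup.closure {x : PuncturedSurfaceGroup g r |
        (∃ i : Fin g, (i : ℕ) < g₀ ∧ (x = PuncturedSurfaceGroup.a i ∨ x = PuncturedSurfaceGroup.b i)) ∨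
        ∃ j : Fin r, s₂ ≤ (j : ℕ) ∧ x = PuncturedSurfaceGroup.c j}).map ι).topologicalClosure)
    (hVm : G.vertGp vm = ((Subgroup.closure {x : PuncturedSurfaceGroup g r |
        (∃ i : Fin g, (g₀ ≤ (i : ℕ) ∧ (i : ℕ) < g₁) ∧
          (x = PuncturedSurfaceGroup.a i ∨ x = PuncturedSurfaceGroup.b i)) ∨
        (∃ j : Fin r, (s₁ ≤ (j : ℕ) ∧ (j : ℕ) < s₂) ∧ x = PuncturedSurfaceGroup.c j) ∨
        x = εA ∨ x = η}).map ι).topologicalClosure)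
    (hV₁ : G.vertGp v₁ = ((Subgroup.closure {x : PuncturedSurfaceGroup g r |
        (∃ i : Fin g, g₁ ≤ (i : ℕ) ∧ (x = PuncturedSurfaceGroup.a i ∨ x = PuncturedSurfaceGroup.b i)) ∨
        (∃ j : Fin r, (j : ℕ) < s₁ ∧ x = PuncturedSurfaceGroup.c j) ∨ x = η}).map ι).topologicalClosure)
    (nA nB : G.graph.N) (hN : ∀ n, n = nA ∨ n = nB)
    (hEA : G.nodeGp nA = ((Subgroup.zpowers εA).map ι).topologicalClosure)
    (hEB : G.nodeGp nB = ((Subgroup.zpowers η).map ι).topologicalClosure) :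
    G.VerticialSeparatingCoverings := by
  classical
  -- the three vertices are distinct (their groups are, by the free-factor package of gen 3)
  obtain ⟨-, -, -, -, -, -, -, -, -, ⟨h0m, hm1, h01, -⟩, -⟩ := G.threeChain_freeFactor_package hne hprime ι hι
    hg hs₁ hs₁₂ hs₂ e hC v₀ vm v₁ hV εA η hεA hη hV₀ hVm hV₁ nA nB hN hEA hEB
  have hv0m : v₀ ≠ vm := fun h => h0m (by rw [h])
  have hvm1 : vm ≠ v₁ := fun h => hm1 (by rw [h])
  have hv01 : v₀ ≠ v₁ := fun h => h01 (by rw [h])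
  obtain ⟨r', rfl⟩ : ∃ r', r = r' + 1 := ⟨r - 1, by omega⟩
  have hp : ∃ p ∈ Sigma, p.Prime := hne.imp fun p hp => ⟨hp, hprime p hp⟩
  -- the chain basis and the three index sets
  obtain ⟨B, -, -, -, ha, hb, hc, hA, hBη, -, -, -⟩ := exists_chainBases hεA hη hg hs₁ (by omega) (by omega)
  set S₀ : Set ((Fin g × Bool) ⊕ Fin r') :=
    {x | Sum.elim (fun p : Fin g × Bool => (p.1 : ℕ) < g₀) (fun j : Fin r' => s₂ ≤ (j : ℕ) + 1) x} with hS₀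
  set Sm : Set ((Fin g × Bool) ⊕ Fin r') :=
    {x | Sum.elim (fun p : Fin g × Bool => g₀ ≤ (p.1 : ℕ) ∧ (p.1 : ℕ) < g₁)
      (fun j : Fin r' => s₁ ≤ (j : ℕ) + 1 ∧ (j : ℕ) + 1 ≤ s₂) x} with hSm
  set S₁ : Set ((Fin g × Bool) ⊕ Fin r') :=
    {x | Sum.elim (fun p : Fin g × Bool => g₁ ≤ (p.1 : ℕ)) (fun j : Fin r' => (j : ℕ) + 1 ≤ s₁) x} with hS₁
  have h0r : ∀ j : Fin r', (Sum.inr j : (Fin g × Bool) ⊕ Fin r') ∈ S₀ ↔ s₂ ≤ (j : ℕ) + 1 := fun _ => Iff.rfl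
  have hmr : ∀ j : Fin r', (Sum.inr j : (Fin g × Bool) ⊕ Fin r') ∈ Sm ↔
      s₁ ≤ (j : ℕ) + 1 ∧ (j : ℕ) + 1 ≤ s₂ := fun _ => Iff.rfl
  have h1r : ∀ j : Fin r', (Sum.inr j : (Fin g × Bool) ⊕ Fin r') ∈ S₁ ↔ (j : ℕ) + 1 ≤ s₁ := fun _ => Iff.rfl
  -- the three witnesses `c_{s₂+1}`, `c_{s₁+1}`, `c_1` (slots `s₂`, `s₁`, `0`)
  set τ₂ : (Fin g × Bool) ⊕ Fin r' := Sum.inr ⟨s₂, by omega⟩ with hτ₂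
  set τ₁ : (Fin g × Bool) ⊕ Fin r' := Sum.inr ⟨s₁, by omega⟩ with hτ₁
  set κ₀ : (Fin g × Bool) ⊕ Fin r' := Sum.inr ⟨0, by omega⟩ with hκ₀
  have hτ₂0 : τ₂ ∈ S₀ := (h0r _).mpr (by simp only; omega)
  have hτ₂m : τ₂ ∉ Sm := fun h => by have := (hmr _).mp h; simp only at this; omega
  have hτ₂1 : τ₂ ∉ S₁ := fun h => by have := (h1r _).mp h; simp only at this; omega
  have hτ₁m : τ₁ ∈ Sm := (hmr _).mpr ⟨by simp only; omega, by simp only; omega⟩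
  have hτ₁0 : τ₁ ∉ S₀ := fun h => by have := (h0r _).mp h; simp only at this; omega
  have hτ₁1 : τ₁ ∉ S₁ := fun h => by have := (h1r _).mp h; simp only at this; omega
  have hκ₀1 : κ₀ ∈ S₁ := (h1r _).mpr (by simp only; omega)
  have hκ₀0 : κ₀ ∉ S₀ := fun h => by have := (h0r _).mp h; simp only at this; omega
  have hκ₀m : κ₀ ∉ Sm := fun h => by have := (hmr _).mp h; simp only at this; omega
  -- the vertex groups as sub-basis closures of `B`
  have hA₀ : G.vertGp v₀ = ((Subgroup.closure (B '' S₀)).map ι).topologicalClosure := by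
    rw [hV₀, closure_chainFirst_eq hεA ha hb hc hA (by omega) (by omega)]
  have hAm : G.vertGp vm = ((Subgroup.closure (B '' Sm)).map ι).topologicalClosure := by
    rw [hVm, closure_chainMid_eq hεA hη ha hb hc hA hBη hg (by omega) (by omega) (by omega)]
  have hA₁ : G.vertGp v₁ = ((Subgroup.closure (B '' S₁)).map ι).topologicalClosure := by
    rw [hV₁, closure_chainLast_eq hη ha hb hc hBη (by omega) (by omega) (by omega)]
  -- the index set of a vertex, as a function of the vertex
  let Ss : G.graph.V → Set ((Fin g × Bool) ⊕ Fin r') := fun v =>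
    if v = v₀ then S₀ else if v = vm then Sm else S₁
  have hS0 : Ss v₀ = S₀ := by
    show (if v₀ = v₀ then S₀ else if v₀ = vm then Sm else S₁) = S₀
    rw [if_pos rfl]
  have hSm' : Ss vm = Sm := by
    show (if vm = v₀ then S₀ else if vm = vm then Sm else S₁) = Sm
    rw [if_neg (Ne.symm hv0m), if_pos rfl]
  have hS1 : Ss v₁ = S₁ := by
    show (if v₁ = v₀ then S₀ else if v₁ = vm then Sm else S₁) = S₁
    rw [if_neg (Ne.symm hv01), if_neg (Ne.symm hvm1)]
  have hv : ∀ v, G.vertGp v = ((Subgroup.closure (B '' Ss v)).map ι).topologicalClosure := by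
    intro v
    rcases hV v with rfl | rfl | rfl
    · rw [hS0]; exact hA₀
    · rw [hSm']; exact hAm
    · rw [hS1]; exact hA₁
  have hSsne : ∀ v, (Ss v).Nonempty := by
    intro v
    rcases hV v with rfl | rfl | rfl
    · rw [hS0]; exact ⟨τ₂, hτ₂0⟩
    · rw [hSm']; exact ⟨τ₁, hτ₁m⟩
    · rw [hS1]; exact ⟨κ₀, hκ₀1⟩
  -- the projections killing `B(S_v)`
  let ρs : G.graph.V → (PuncturedSurfaceGroup g (r' + 1) →* PuncturedSurfaceGroup g (r' + 1)) := fun v =>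
    B.lift fun j => if j ∈ Ss v then 1 else B j
  have hρs : ∀ v j, ρs v (B j) = if j ∈ Ss v then 1 else B j := fun v j => B.lift_apply_basis _ j
  -- basis members are nontrivial and lie in the closure of their sub-basis
  haveI : IsFreeGroup (PuncturedSurfaceGroup g (r' + 1)) := B.isFreeGroup
  have hB1 : ∀ j, B j ≠ 1 := fun j h => by
    have := congrArg B.repr h
    rw [FreeGroupBasis.repr_apply_coe, map_one] at this
    exact FreeGroup.of_ne_one _ this
  have hmem : ∀ (v : G.graph.V) (j : (Fin g × Bool) ⊕ Fin r'), j ∈ Ss v → ι (B j) ∈ G.vertGp v := by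
    intro v j hj
    rw [hv v]
    exact Subgroup.le_topologicalClosure _
      (Subgroup.mem_map_of_mem ι (Subgroup.subset_closure ⟨j, hj, rfl⟩))
  have hfix : ∀ (v : G.graph.V) (j : (Fin g × Bool) ⊕ Fin r'), j ∉ Ss v → ρs v (B j) ≠ 1 := by
    intro v j hj
    rw [hρs v j, if_neg hj]
    exact hB1 j
  -- cross-vertex witnesses
  have hsep : ∀ w₁ w₂ : G.graph.V, w₁ ≠ w₂ → ∃ x : PuncturedSurfaceGroup g (r' + 1),
      ι x ∈ G.vertGp w₁ ∧ ρs w₂ x ≠ 1 := by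
    intro w₁ w₂ h12
    rcases hV w₁ with rfl | rfl | rfl <;> rcases hV w₂ with rfl | rfl | rfl
    · exact absurd rfl h12
    · exact ⟨B τ₂, hmem _ τ₂ (by rw [hS0]; exact hτ₂0), hfix _ τ₂ (by rw [hSm']; exact hτ₂m)⟩
    · exact ⟨B τ₂, hmem _ τ₂ (by rw [hS0]; exact hτ₂0), hfix _ τ₂ (by rw [hS1]; exact hτ₂1)⟩
    · exact ⟨B τ₁, hmem _ τ₁ (by rw [hSm']; exact hτ₁m), hfix _ τ₁ (by rw [hS0]; exact hτ₁0)⟩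
    · exact absurd rfl h12
    · exact ⟨B τ₁, hmem _ τ₁ (by rw [hSm']; exact hτ₁m), hfix _ τ₁ (by rw [hS1]; exact hτ₁1)⟩
    · exact ⟨B κ₀, hmem _ κ₀ (by rw [hS1]; exact hκ₀1), hfix _ κ₀ (by rw [hS0]; exact hκ₀0)⟩
    · exact ⟨B κ₀, hmem _ κ₀ (by rw [hS1]; exact hκ₀1), hfix _ κ₀ (by rw [hSm']; exact hκ₀m)⟩
    · exact absurd rfl h12
  exact G.verticialSeparatingCoverings_of_freeFactors' hι hp (fun _ => B) Ss hSsne hv ρs hρs hsep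

end PSCDatum

end Literature.AnabelianGeometry.SemiGraphs

end
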